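import Summits.BirchSwinnertonDyer.BirchSwinnertonDyer.Theorems.EisensteinPrimesLocalBalanceAtGoodPlace
import HarnessLib

/-!
# Crux 3 `MazurMCOnCellB` (stmt-BirchSwinnertonDyer-19033), line `twistback` v12 — lane ISO-3b:
# the sub-row datum of the registered stub has a CANONICAL `S₀` (= the bad places `≠ 3`)

Width seat bsd-line-x2-p1-w7 (gen 4), cell `bsd-eis` (run/shared/lean/pub/bsd-eis/), 2026-08-29; sequel of
`…EisensteinPrimesLocalBalanceAtGoodPlace` (ISO-3: Greenberg–Vatsal Prop. (2.4) at a good place). HONEST FRAMING: TOOL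
THEOREMS ONLY (no `def`, no named fact, no `sorry`); `--supports` stmt-BirchSwinnertonDyer-19033; closes no stub; no
summit statement, no Mazur main conjecture, no BSD is proved for any curve; 0 cells / labels / stubs / tiers move.

The first (negated) hypothesis of `stub_offSubrow_connectedShaUnitOrPartner` (twistback v12, VERBATIM v5–v12) quantifies
over a finite set `S₀` of places `∌ (3)` off which the curve is good — so `S₀` CONTAINS the bad places `≠ 3` and MAY
contain good ones. By ISO-3 (`balance_iff_sdiff_of_good`: at a good place the summand equals `δ`) the good places are
idle: the datum holds iff it holds with `S₀` = EXACTLY the bad places other than `(3)`.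

* `subrowDatum_iff_canonical` — «datum» ↔ «datum with the extra clause `∀ v ∈ S₀, ¬ W.HasGoodReductionAt v`»;
* `subrowDatum_canonical` — the forward direction alone (what consumers use: every kernel evaluation of the identity,
  `…SubrowReducedBalance` / `…UnramifiedAtMultiplicativePlace` / `…LocalBalanceAtUnramifiedPlace`, assumes the places of
  `S₀` are multiplicative or additive).

References: [GreenbergVatsal2000] §2 Prop. (2.4) p. 22, §3 (28) p. 42.
-/

set_option autoImplicit false

-- `Summit.BirchSwinnertonDyer.BirchSwinnertonDyer.…`: the summit and its single sub-problem share a name.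
set_option linter.dupNamespace false

noncomputable section

open scoped Classical

open NumberField IsDedekindDomain Field WeierstrassCurve
  Literature.NumberTheory.EllipticCurves Literature.NumberTheory.GaloisRepresentations
  Literature.NumberTheory.EllipticCurves.GreenbergVatsal2000
  Literature.NumberTheory.EllipticCurves.Rank1Residual
  Summit.BirchSwinnertonDyer.Rank1Residual.X2
  Summit.BirchSwinnertonDyer.BirchSwinnertonDyer.Theorems.EisensteinPrimesLocalBalanceAtGoodPlace

namespace Summit.BirchSwinnertonDyer.BirchSwinnertonDyer.Theorems.EisensteinPrimesMazurMCOnCellBTwistbackSubrowDatumCanonical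

variable {W : WeierstrassCurve ℚ} [W.IsElliptic]

/-- **CANONICAL `S₀`.** The sub-row datum of the registered stub (VERBATIM) holds iff it holds with `S₀` consisting of
BAD places only (hence `S₀` = exactly the bad places other than `(3)`): drop the good places of `S₀`
(`balance_iff_sdiff_of_good`), they stay good outside. [cite: GreenbergVatsal2000, §2 Prop. (2.4) (p. 22) and §3 (28) p. 42] -/
theorem subrowDatum_iff_canonical (q : ℕ) :
    (q = 3 ∧ ¬ W.HasSplitMultiplicativeReductionAtPrime 3 ∧
      ∃ (Φ₀ : AddSubgroup (geomTorsion W (3 : ℤ))) (m : ℕ) (_ : NeZero m) (φ : DirichletCharacter (ZMod 3) m)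
        (d : ℕ) (_ : NeZero d) (ψ : DirichletCharacter (ZMod 3) d) (S₀ : Finset (HeightOneSpectrum (𝓞 ℚ))),
        IsRationalLine W 3 Φ₀ ∧ φ.IsPrimitive ∧ ψ.IsPrimitive ∧
        (∀ (σ : absoluteGaloisGroup ℚ), ∀ P ∈ Φ₀,
          σ • P = (φ ((modNCyclotomicCharacter ℚ m σ : (ZMod m)ˣ) : ZMod m)).val • P) ∧
        (∀ (σ : absoluteGaloisGroup ℚ) (P : geomTorsion W (3 : ℤ)),
          σ • P - (ψ ((modNCyclotomicCharacter ℚ d σ : (ZMod d)ˣ) : ZMod d)).val • P ∈ Φ₀) ∧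
        (∀ v ∈ S₀, ((3 : ℕ) : 𝓞 ℚ) ∉ v.asIdeal) ∧
        (∀ v : HeightOneSpectrum (𝓞 ℚ), v ∉ S₀ → ((3 : ℕ) : 𝓞 ℚ) ∉ v.asIdeal → W.HasGoodReductionAt v) ∧
        1 + ∑ v ∈ S₀, delta W 3 v =
          ∑ v ∈ S₀, ((if φ (Rat.HeightOneSpectrum.natGenerator v : ZMod m) =
                (Rat.HeightOneSpectrum.natGenerator v : ZMod 3)
              then sFactor 3 (Rat.HeightOneSpectrum.natGenerator v) else 0) +
            (if ψ (Rat.HeightOneSpectrum.natGenerator v : ZMod d) =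
                (Rat.HeightOneSpectrum.natGenerator v : ZMod 3)
              then sFactor 3 (Rat.HeightOneSpectrum.natGenerator v) else 0))) ↔
    (q = 3 ∧ ¬ W.HasSplitMultiplicativeReductionAtPrime 3 ∧
      ∃ (Φ₀ : AddSubgroup (geomTorsion W (3 : ℤ))) (m : ℕ) (_ : NeZero m) (φ : DirichletCharacter (ZMod 3) m)
        (d : ℕ) (_ : NeZero d) (ψ : DirichletCharacter (ZMod 3) d) (S₀ : Finset (HeightOneSpectrum (𝓞 ℚ))),
        IsRationalLine W 3 Φ₀ ∧ φ.IsPrimitive ∧ ψ.IsPrimitive ∧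
        (∀ (σ : absoluteGaloisGroup ℚ), ∀ P ∈ Φ₀,
          σ • P = (φ ((modNCyclotomicCharacter ℚ m σ : (ZMod m)ˣ) : ZMod m)).val • P) ∧
        (∀ (σ : absoluteGaloisGroup ℚ) (P : geomTorsion W (3 : ℤ)),
          σ • P - (ψ ((modNCyclotomicCharacter ℚ d σ : (ZMod d)ˣ) : ZMod d)).val • P ∈ Φ₀) ∧
        (∀ v ∈ S₀, ((3 : ℕ) : 𝓞 ℚ) ∉ v.asIdeal) ∧
        (∀ v : HeightOneSpectrum (𝓞 ℚ), v ∉ S₀ → ((3 : ℕ) : 𝓞 ℚ) ∉ v.asIdeal → W.HasGoodReductionAt v) ∧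
        (∀ v ∈ S₀, ¬ W.HasGoodReductionAt v) ∧
        1 + ∑ v ∈ S₀, delta W 3 v =
          ∑ v ∈ S₀, ((if φ (Rat.HeightOneSpectrum.natGenerator v : ZMod m) =
                (Rat.HeightOneSpectrum.natGenerator v : ZMod 3)
              then sFactor 3 (Rat.HeightOneSpectrum.natGenerator v) else 0) +
            (if ψ (Rat.HeightOneSpectrum.natGenerator v : ZMod d) =
                (Rat.HeightOneSpectrum.natGenerator v : ZMod 3)
              then sFactor 3 (Rat.HeightOneSpectrum.natGenerator v) else 0))) := by
  constructor
  · rintro ⟨hq, hns, Φ₀, m, _, φ, d, _, ψ, S₀, hΦ, hφ, hψ, hφ0, hψ0, hS3, hgood, hbal⟩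
    -- drop the good places `T` of `S₀`
    set T : Finset (HeightOneSpectrum (𝓞 ℚ)) := S₀.filter (fun v ↦ W.HasGoodReductionAt v) with hT
    have hTS : T ⊆ S₀ := Finset.filter_subset _ _
    have hTgood : ∀ v ∈ T, W.HasGoodReductionAt v := fun v hv ↦ (Finset.mem_filter.mp hv).2
    refine ⟨hq, hns, Φ₀, m, inferInstance, φ, d, inferInstance, ψ, S₀ \ T, hΦ, hφ, hψ, hφ0, hψ0,
      fun v hv ↦ hS3 v (Finset.sdiff_subset hv), ?_, ?_, ?_⟩
    · intro v hv h3
      by_cases hvS : v ∈ S₀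
      · have hvT : v ∈ T := by
          by_contra hvT
          exact hv (Finset.mem_sdiff.mpr ⟨hvS, hvT⟩)
        exact hTgood v hvT
      · exact hgood v hvS h3
    · intro v hv hgv
      obtain ⟨hvS, hvT⟩ := Finset.mem_sdiff.mp hv
      exact hvT (Finset.mem_filter.mpr ⟨hvS, hgv⟩)
    · exact (balance_iff_sdiff_of_good hΦ hφ hψ hφ0 hψ0 hTS hS3 hTgood 1).mp hbal
  · rintro ⟨hq, hns, Φ₀, m, _, φ, d, _, ψ, S₀, hΦ, hφ, hψ, hφ0, hψ0, hS3, hgood, -, hbal⟩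
    exact ⟨hq, hns, Φ₀, m, inferInstance, φ, d, inferInstance, ψ, S₀, hΦ, hφ, hψ, hφ0, hψ0, hS3, hgood, hbal⟩

/-- **The canonical form, forward direction**: from the VERBATIM datum, the datum whose `S₀` consists of bad places only
— the shape every kernel evaluation of the identity assumes (`S₀ = M ∪ A`, multiplicative and additive places).
[cite: GreenbergVatsal2000, §2 Prop. (2.4) (p. 22) and §3 (28) p. 42] -/
theorem subrowDatum_canonical (q : ℕ)
    (hD : q = 3 ∧ ¬ W.HasSplitMultiplicativeReductionAtPrime 3 ∧
      ∃ (Φ₀ : AddSubgroup (geomTorsion W (3 : ℤ))) (m : ℕ) (_ : NeZero m) (φ : DirichletCharacter (ZMod 3) m)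
        (d : ℕ) (_ : NeZero d) (ψ : DirichletCharacter (ZMod 3) d) (S₀ : Finset (HeightOneSpectrum (𝓞 ℚ))),
        IsRationalLine W 3 Φ₀ ∧ φ.IsPrimitive ∧ ψ.IsPrimitive ∧
        (∀ (σ : absoluteGaloisGroup ℚ), ∀ P ∈ Φ₀,
          σ • P = (φ ((modNCyclotomicCharacter ℚ m σ : (ZMod m)ˣ) : ZMod m)).val • P) ∧
        (∀ (σ : absoluteGaloisGroup ℚ) (P : geomTorsion W (3 : ℤ)),
          σ • P - (ψ ((modNCyclotomicCharacter ℚ d σ : (ZMod d)ˣ) : ZMod d)).val • P ∈ Φ₀) ∧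
        (∀ v ∈ S₀, ((3 : ℕ) : 𝓞 ℚ) ∉ v.asIdeal) ∧
        (∀ v : HeightOneSpectrum (𝓞 ℚ), v ∉ S₀ → ((3 : ℕ) : 𝓞 ℚ) ∉ v.asIdeal → W.HasGoodReductionAt v) ∧
        1 + ∑ v ∈ S₀, delta W 3 v =
          ∑ v ∈ S₀, ((if φ (Rat.HeightOneSpectrum.natGenerator v : ZMod m) =
                (Rat.HeightOneSpectrum.natGenerator v : ZMod 3)
              then sFactor 3 (Rat.HeightOneSpectrum.natGenerator v) else 0) +
            (if ψ (Rat.HeightOneSpectrum.natGenerator v : ZMod d) =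
                (Rat.HeightOneSpectrum.natGenerator v : ZMod 3)
              then sFactor 3 (Rat.HeightOneSpectrum.natGenerator v) else 0))) :
    ∃ (Φ₀ : AddSubgroup (geomTorsion W (3 : ℤ))) (m : ℕ) (_ : NeZero m) (φ : DirichletCharacter (ZMod 3) m)
        (d : ℕ) (_ : NeZero d) (ψ : DirichletCharacter (ZMod 3) d) (S₀ : Finset (HeightOneSpectrum (𝓞 ℚ))),
        IsRationalLine W 3 Φ₀ ∧ φ.IsPrimitive ∧ ψ.IsPrimitive ∧
        (∀ (σ : absoluteGaloisGroup ℚ), ∀ P ∈ Φ₀,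
          σ • P = (φ ((modNCyclotomicCharacter ℚ m σ : (ZMod m)ˣ) : ZMod m)).val • P) ∧
        (∀ (σ : absoluteGaloisGroup ℚ) (P : geomTorsion W (3 : ℤ)),
          σ • P - (ψ ((modNCyclotomicCharacter ℚ d σ : (ZMod d)ˣ) : ZMod d)).val • P ∈ Φ₀) ∧
        (∀ v ∈ S₀, ((3 : ℕ) : 𝓞 ℚ) ∉ v.asIdeal) ∧
        (∀ v : HeightOneSpectrum (𝓞 ℚ), v ∉ S₀ → ((3 : ℕ) : 𝓞 ℚ) ∉ v.asIdeal → W.HasGoodReductionAt v) ∧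
        (∀ v ∈ S₀, ¬ W.HasGoodReductionAt v) ∧
        1 + ∑ v ∈ S₀, delta W 3 v =
          ∑ v ∈ S₀, ((if φ (Rat.HeightOneSpectrum.natGenerator v : ZMod m) =
                (Rat.HeightOneSpectrum.natGenerator v : ZMod 3)
              then sFactor 3 (Rat.HeightOneSpectrum.natGenerator v) else 0) +
            (if ψ (Rat.HeightOneSpectrum.natGenerator v : ZMod d) =
                (Rat.HeightOneSpectrum.natGenerator v : ZMod 3)
              then sFactor 3 (Rat.HeightOneSpectrum.natGenerator v) else 0)) :=
  ((subrowDatum_iff_canonical q).mp hD).2.2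

end Summit.BirchSwinnertonDyer.BirchSwinnertonDyer.Theorems.EisensteinPrimesMazurMCOnCellBTwistbackSubrowDatumCanonical

end
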